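import Summits.QuantumFields.YangMills.Theses.ContractibleFibre

/-!
# `FibreAnchor` — negative lemmas, part 1/3: the free-tube vocabulary, no junk, and the
# dangling-link symmetry (crux stmt-QuantumFields-16243, route `ContractibleFibre`; cdisprove
# cycle 1, importable extract of `Summits/QuantumFields/YangMills/Cruxes/FibreAnchor/Disproof.lean`)

The crux `Summit.QuantumFields.YangMills.Theses.ContractibleFibre.FibreAnchor` states its free-tube
Wilson measure through a 40-line inline `let` chain. This file names that chain
(`St, Cfg, haarPi, sh, ins, pl, act, wgt, Ex, shiftT` — DEFINITIONALLY the crux's `let`s: the crux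
is by `Iff.rfl` the `2 * n < L` clustering clause over them; these are the only definitions of the
three parts, together with the symmetry `mulDir` and the one-link indicator `obs`) and proves the
facts every user of the crux needs:

* no junk: the weight `wgt = exp(act)` is continuous, positive, bounded, measurable and
  integrable (second countability / Hausdorffness of `G` through the faithful `r`, tree
  `LatticeRep.secondCountableTopology`-style one-liners), the partition function is `> 0`
  (`Z_pos`), so `Ex` is a genuine normalised positive functional (`Ex_eq`, `Ex_const_mul`);
* the dangling-link symmetry at fibre width `M = 0`: every direction-`2` link lies in no plaquette
  (`ins_zero_eq_zero`), the action is invariant under left-multiplying all of them by any `g`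
  (`act_mulDir`), that map preserves product Haar (`measurePreserving_mulDir`), hence
  `∫ F∘mulDir_g · wgt = ∫ F · wgt` (`integral_comp_mulDir`).

Parts 2/3 (`DanglingLink`) and 3/3 (`LoadBearingClauses`) use these to prove three clauses of the
crux necessary.
-/

set_option autoImplicit false

noncomputable section

open MeasureTheory
open Literature.MathematicalPhysics.QuantumFieldTheory
open Summit.QuantumFields.YangMills.Theses.ContractibleFibre

namespace Summit.QuantumFields.YangMills.Theorems.FibreAnchor.Negative.TubeVocabulary

/-! ## Vocabulary — the crux's inline `let`s as named definitions (definitionally equal) -/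

section Vocabulary

variable (G : Type) [Group G] [TopologicalSpace G] [IsTopologicalGroup G] [CompactSpace G]
  [MeasurableSpace G] [BorelSpace G]

/-- Sites of the free tube `(ℤ/L)² × Fin (M+1)²` (time, space, two fibre coordinates). -/
abbrev St (L M : ℕ) : Type := ZMod L × ZMod L × Fin (M + 1) × Fin (M + 1)

/-- Link configurations of the free tube. -/
abbrev Cfg (L M : ℕ) : Type := St L M × Fin 4 → G

/-- Product Haar probability measure on the links (the crux's `ν`). -/
def haarPi (L M : ℕ) [NeZero L] : Measure (Cfg G L M) :=
  Measure.pi fun _ => haarProbability G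

/-- The crux's `sh` (one step in direction `μ`). -/
def sh (L M : ℕ) : St L M → Fin 4 → St L M := fun x μ =>
  ![(x.1 + 1, x.2.1, x.2.2.1, x.2.2.2), (x.1, x.2.1 + 1, x.2.2.1, x.2.2.2),
    (x.1, x.2.1, x.2.2.1 + 1, x.2.2.2), (x.1, x.2.1, x.2.2.1, x.2.2.2 + 1)] μ

/-- The crux's `ins` (plaquette inside the tube: free fibre faces). -/
def ins (L M : ℕ) : St L M → Fin 4 → Fin 4 → ℝ := fun x μ κ =>
  if ((μ = 2 ∨ κ = 2) → (x.2.2.1 : ℕ) < M) ∧ ((μ = 3 ∨ κ = 3) → (x.2.2.2 : ℕ) < M) then 1 else 0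

/-- The crux's `pl` (plaquette holonomy). -/
def pl (L M : ℕ) : Cfg G L M → St L M → Fin 4 → Fin 4 → G := fun U x μ κ =>
  U (x, μ) * U (sh L M x μ, κ) * (U (sh L M x κ, μ))⁻¹ * (U (x, κ))⁻¹

/-- The crux's `act` (Wilson action of the free tube at coupling `β`). -/
def act (r : LatticeRep G) (L M : ℕ) [NeZero L] (β : ℝ) : Cfg G L M → ℝ := fun U =>
  β * ∑ x : St L M, ∑ q : {q : Fin 4 × Fin 4 // q.1 < q.2},
    ins L M x q.1.1 q.1.2 * (r.ρ (pl G L M U x q.1.1 q.1.2)).trace.re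

/-- The crux's `wgt`. -/
def wgt (r : LatticeRep G) (L M : ℕ) [NeZero L] (β : ℝ) : Cfg G L M → ℝ := fun U =>
  Real.exp (act G r L M β U)

/-- The crux's `Ex` (ratio-of-integrals expectation). -/
def Ex (r : LatticeRep G) (L M : ℕ) [NeZero L] (β : ℝ) : (Cfg G L M → ℝ) → ℝ := fun F =>
  (∫ U, F U * wgt G r L M β U ∂(haarPi G L M)) / (∫ U, wgt G r L M β U ∂(haarPi G L M))

/-- The crux's `σ` (time shift by `n`). -/
def shiftT (L M : ℕ) : ℕ → Cfg G L M → Cfg G L M := fun n U p => U ((p.1.1 + n, p.1.2), p.2)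

end Vocabulary

/-! ## (N) No junk: topology and measure theory of the vocabulary -/


section GroupOnly

variable {G : Type} [Group G]

/-- Left-multiply every direction-`2` link by `g` (a symmetry of the `M = 0` tube, where all
direction-`2` links are dangling). -/
def mulDir (g : G) (L M : ℕ) : Cfg G L M → Cfg G L M := fun U p =>
  if p.2 = 2 then g * U p else U p

/-- `mulDir` fixes links of direction `≠ 2`. -/
theorem mulDir_apply_of_ne {g : G} {L M : ℕ} (U : Cfg G L M) {p : St L M × Fin 4}
    (hp : p.2 ≠ 2) : mulDir g L M U p = U p := by
  simp [mulDir, hp]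

/-- `mulDir` left-multiplies links of direction `2`. -/
theorem mulDir_apply_two {g : G} {L M : ℕ} (U : Cfg G L M) (x : St L M) :
    mulDir g L M U (x, 2) = g * U (x, 2) := by
  simp [mulDir]

/-- **(D)** At fibre width `M = 0` every plaquette touching direction `2` or `3` is switched off:
all direction-`2`/`3` links are dangling. -/
theorem ins_zero_eq_zero {L : ℕ} (x : St L 0) {μ κ : Fin 4}
    (h : μ = 2 ∨ κ = 2 ∨ μ = 3 ∨ κ = 3) : ins L 0 x μ κ = 0 := by
  unfold ins
  rw [if_neg]
  rintro ⟨h2, h3⟩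
  rcases h with h | h | h | h
  · exact absurd (h2 (Or.inl h)) (Nat.not_lt_zero _)
  · exact absurd (h2 (Or.inr h)) (Nat.not_lt_zero _)
  · exact absurd (h3 (Or.inl h)) (Nat.not_lt_zero _)
  · exact absurd (h3 (Or.inr h)) (Nat.not_lt_zero _)

/-- Plaquettes avoiding direction `2` do not see the direction-`2` links. -/
theorem pl_mulDir_of_ne (g : G) {L M : ℕ} (U : Cfg G L M) (x : St L M) {μ κ : Fin 4}
    (hμ : μ ≠ 2) (hκ : κ ≠ 2) : pl G L M (mulDir g L M U) x μ κ = pl G L M U x μ κ := by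
  unfold pl
  rw [mulDir_apply_of_ne U (p := (x, μ)) hμ, mulDir_apply_of_ne U (p := (sh L M x μ, κ)) hκ,
    mulDir_apply_of_ne U (p := (sh L M x κ, μ)) hμ, mulDir_apply_of_ne U (p := (x, κ)) hκ]

variable [TopologicalSpace G]

/-- **(D)** The `M = 0` action is blind to the direction-`2` links. -/
theorem act_mulDir (r : LatticeRep G) (g : G) (L : ℕ) [NeZero L] (β : ℝ) (U : Cfg G L 0) :
    act G r L 0 β (mulDir g L 0 U) = act G r L 0 β U := by
  unfold act
  congr 1
  refine Finset.sum_congr rfl fun x _ => Finset.sum_congr rfl fun q _ => ?_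
  by_cases h : q.1.1 = 2 ∨ q.1.2 = 2 ∨ q.1.1 = 3 ∨ q.1.2 = 3
  · rw [ins_zero_eq_zero x h, zero_mul, zero_mul]
  · push Not at h
    rw [pl_mulDir_of_ne g U x h.1 h.2.1]

/-- The `M = 0` weight is blind to the direction-`2` links. -/
theorem wgt_mulDir (r : LatticeRep G) (g : G) (L : ℕ) [NeZero L] (β : ℝ) (U : Cfg G L 0) :
    wgt G r L 0 β (mulDir g L 0 U) = wgt G r L 0 β U := by
  unfold wgt
  rw [act_mulDir]

/-- The weight is strictly positive. -/
theorem wgt_pos (r : LatticeRep G) (L M : ℕ) [NeZero L] (β : ℝ) (U : Cfg G L M) :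
    0 < wgt G r L M β U :=
  Real.exp_pos _

end GroupOnly

section Core

variable {G : Type} [Group G] [TopologicalSpace G] [IsTopologicalGroup G] [CompactSpace G]
  [MeasurableSpace G] [BorelSpace G]

/-- Product Haar on the links is a probability measure. -/
instance haarPi.instIsProbabilityMeasure (L M : ℕ) [NeZero L] :
    IsProbabilityMeasure (haarPi G L M) := by
  unfold haarPi; infer_instance

/-- The Haar probability measure is left invariant (instance made visible through the
definition). -/
theorem isMulLeftInvariant_haarProbability :
    Measure.IsMulLeftInvariant (haarProbability G) := by
  unfold haarProbability; infer_instance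

omit [CompactSpace G] [MeasurableSpace G] [BorelSpace G] in
/-- The plaquette holonomy is continuous in the configuration. -/
theorem continuous_pl (L M : ℕ) (x : St L M) (μ κ : Fin 4) :
    Continuous fun U : Cfg G L M => pl G L M U x μ κ := by
  unfold pl
  exact (((continuous_apply (x, μ)).mul (continuous_apply (sh L M x μ, κ))).mul
    ((continuous_apply (sh L M x κ, μ)).inv)).mul ((continuous_apply (x, κ)).inv)

omit [CompactSpace G] [MeasurableSpace G] [BorelSpace G] in
/-- The free-tube action is continuous. -/
theorem continuous_act (r : LatticeRep G) (L M : ℕ) [NeZero L] (β : ℝ) :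
    Continuous (act G r L M β) := by
  unfold act
  refine continuous_const.mul (continuous_finsetSum _ fun x _ => ?_)
  refine continuous_finsetSum _ fun q _ => continuous_const.mul ?_
  exact Complex.continuous_re.comp ((r.continuous.comp (continuous_pl L M x _ _)).matrix_trace)

omit [CompactSpace G] [MeasurableSpace G] [BorelSpace G] in
/-- The weight is continuous. -/
theorem continuous_wgt (r : LatticeRep G) (L M : ℕ) [NeZero L] (β : ℝ) :
    Continuous (wgt G r L M β) :=
  Real.continuous_exp.comp (continuous_act r L M β)

/-- The weight is measurable (second countability of `G` through `r`). -/
theorem measurable_wgt (r : LatticeRep G) (L M : ℕ) [NeZero L] (β : ℝ) :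
    Measurable (wgt G r L M β) := by
  haveI := (r.continuous.isClosedEmbedding r.injective).isEmbedding.secondCountableTopology
  exact (continuous_wgt r L M β).measurable

omit [MeasurableSpace G] [BorelSpace G] in
/-- The weight is bounded (continuous on a compact configuration space). -/
theorem exists_wgt_le (r : LatticeRep G) (L M : ℕ) [NeZero L] (β : ℝ) :
    ∃ B : ℝ, ∀ U, wgt G r L M β U ≤ B := by
  obtain ⟨U₀, -, hU₀⟩ :=
    isCompact_univ.exists_isMaxOn Set.univ_nonempty (continuous_wgt r L M β).continuousOn
  exact ⟨wgt G r L M β U₀, fun U => hU₀ (Set.mem_univ U)⟩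

/-- The weight is integrable against product Haar. -/
theorem integrable_wgt (r : LatticeRep G) (L M : ℕ) [NeZero L] (β : ℝ) :
    Integrable (wgt G r L M β) (haarPi G L M) := by
  obtain ⟨B, hB⟩ := exists_wgt_le r L M β
  refine Integrable.of_bound (measurable_wgt r L M β).aestronglyMeasurable B
    (ae_of_all _ fun U => ?_)
  rw [Real.norm_of_nonneg (wgt_pos r L M β U).le]
  exact hB U

/-- `F · wgt` is integrable for a measurable `F` bounded by `B`. -/
theorem integrable_mul_wgt (r : LatticeRep G) (L M : ℕ) [NeZero L] (β : ℝ)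
    {F : Cfg G L M → ℝ} (hF : Measurable F) {B : ℝ} (hFb : ∀ U, |F U| ≤ B) :
    Integrable (fun U => F U * wgt G r L M β U) (haarPi G L M) :=
  (integrable_wgt r L M β).bdd_mul hF.aestronglyMeasurable
    (ae_of_all _ fun U => by simpa [Real.norm_eq_abs] using hFb U)

/-- **(N)** The partition function is strictly positive. -/
theorem Z_pos (r : LatticeRep G) (L M : ℕ) [NeZero L] (β : ℝ) :
    0 < ∫ U, wgt G r L M β U ∂(haarPi G L M) :=
  integral_exp_pos (integrable_wgt r L M β)

/-- `Ex` in terms of the un-normalised functional `J(F) = ∫ F · wgt`. -/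
theorem Ex_eq (r : LatticeRep G) (L M : ℕ) [NeZero L] (β : ℝ) (F : Cfg G L M → ℝ) :
    Ex G r L M β F =
      (∫ U, F U * wgt G r L M β U ∂(haarPi G L M)) / (∫ U, wgt G r L M β U ∂(haarPi G L M)) :=
  rfl

/-- `Ex` is homogeneous. -/
theorem Ex_const_mul (r : LatticeRep G) (L M : ℕ) [NeZero L] (β : ℝ) (s : ℝ)
    (F : Cfg G L M → ℝ) : Ex G r L M β (fun U => s * F U) = s * Ex G r L M β F := by
  rw [Ex_eq, Ex_eq, ← mul_div_assoc, ← integral_const_mul]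
  congr 1
  refine integral_congr_ae (ae_of_all _ fun U => ?_)
  simp only [mul_assoc]

omit [CompactSpace G] in
/-- `mulDir g` is measurable. -/
theorem measurable_mulDir (g : G) (L M : ℕ) : Measurable (mulDir g L M) := by
  refine measurable_pi_lambda _ fun p => ?_
  by_cases hp : p.2 = 2
  · simp only [mulDir, hp, if_true]
    exact (measurable_const_mul g).comp (measurable_pi_apply p)
  · simp only [mulDir, hp, if_false]
    exact measurable_pi_apply p

/-- **(D)** `mulDir g` preserves product Haar (left invariance of Haar, factorwise). -/
theorem measurePreserving_mulDir (g : G) (L M : ℕ) [NeZero L] :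
    MeasurePreserving (mulDir g L M) (haarPi G L M) (haarPi G L M) := by
  haveI := isMulLeftInvariant_haarProbability (G := G)
  have hf : ∀ p : St L M × Fin 4, MeasurePreserving
      ((fun (p : St L M × Fin 4) (x : G) => if p.2 = 2 then g * x else x) p)
      (haarProbability G) (haarProbability G) := by
    intro p
    by_cases hp : p.2 = 2
    · simp only [hp, if_true]
      exact measurePreserving_mul_left (haarProbability G) g
    · simp only [hp, if_false]
      exact MeasurePreserving.id _
  exact measurePreserving_pi (fun _ => haarProbability G) (fun _ => haarProbability G) hf

/-- **(D) Invariance of the un-normalised functional** under the dangling-link symmetry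
(`M = 0`). -/
theorem integral_comp_mulDir (r : LatticeRep G) (g : G) (L : ℕ) [NeZero L] (β : ℝ)
    {F : Cfg G L 0 → ℝ} (hF : Measurable F) :
    ∫ U, F (mulDir g L 0 U) * wgt G r L 0 β U ∂(haarPi G L 0) =
      ∫ U, F U * wgt G r L 0 β U ∂(haarPi G L 0) := by
  have hmp := measurePreserving_mulDir (G := G) g L 0
  have h2 : ∫ V, F V * wgt G r L 0 β V ∂(Measure.map (mulDir g L 0) (haarPi G L 0)) =
      ∫ U, F (mulDir g L 0 U) * wgt G r L 0 β (mulDir g L 0 U) ∂(haarPi G L 0) :=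
    integral_map hmp.measurable.aemeasurable
      (by rw [hmp.map_eq]; exact (hF.mul (measurable_wgt r L 0 β)).aestronglyMeasurable)
  rw [hmp.map_eq] at h2
  calc ∫ U, F (mulDir g L 0 U) * wgt G r L 0 β U ∂(haarPi G L 0)
      = ∫ U, F (mulDir g L 0 U) * wgt G r L 0 β (mulDir g L 0 U) ∂(haarPi G L 0) := by
        simp only [wgt_mulDir]
    _ = ∫ V, F V * wgt G r L 0 β V ∂(haarPi G L 0) := h2.symm

end Core

section Obs

variable {G : Type}

/-- The indicator of `{U (x₀, 2) ∈ O}`: an observable of ONE direction-`2` link. At `M = 0`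
that link is dangling (in no plaquette), so its law under the tube measure is exactly Haar. -/
def obs (O : Set G) {L : ℕ} (x₀ : St L 0) : Cfg G L 0 → ℝ := fun U =>
  O.indicator (fun _ => (1 : ℝ)) (U (x₀, 2))

end Obs

end Summit.QuantumFields.YangMills.Theorems.FibreAnchor.Negative.TubeVocabulary

end
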